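import Summits.BirchSwinnertonDyer.BirchSwinnertonDyer.Theorems.ResidualThetaTransportAtTwoResidualSignedLambdaLowerCMAtTwoDeepHalfAtTwoAssembly
import Summits.BirchSwinnertonDyer.BirchSwinnertonDyer.Theorems.ResidualThetaTransportAtTwoResidualSignedLambdaLowerCMAtTwoCofreeSelmerTransferRelaxed
import Summits.BirchSwinnertonDyer.BirchSwinnertonDyer.Theorems.ResidualThetaTransportAtTwoResidualSignedLambdaLowerCMAtTwoRhoLayerPairingConj
import HarnessLib

/-!
# Item 6 (S4₂) FROM THE PINS: `∃ x, locd₂ x = z` with levelwise STRICTNESS at `S₀` — the assembly (p695648) with its levelwise orthogonality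
# DISCHARGED by GLUE-67 (p695317) — and the first links of the `S₀`-pin transfer (S95 (1)–(3)) in the AwayTwo frame's currency

Route `ResidualThetaTransportAtTwo` (RTT), crux RSL_g `ResidualSignedLambdaLowerCMAtTwo` (stmt-BirchSwinnertonDyer-22608), line «onepair», split item
S4₂ `stub_deepHalfAtTwoStrict`; seat `prover-bsd-wall-tp2-p2x-w2` g19 (`--supports`, closes nothing). THEOREMS ONLY (no definition, no named fact,
no instance, no `sorry`). STUB-PLAN rev 22 S94/S95. BSD is not proved by any of this; RSL_g (22608) stays OPEN.

* §1 (S95 (1)–(3), pin-free) **`layerPairingOf_reduce_conjMap_eq_zero_of_resOfLe_decomp_eq_zero`**: the Greenberg–Vatsal strictness clause of the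
  assembly's output, «`conj_σ (red_{p^k}(proj_n x))` dies on `Γ_n ∩ D_w`», gives, for ANY datum `e` on `A_ρ[p^k]`, the vanishing of the layer
  pairing `layerPairingOf … κ w n (red_{p^k}(conjMap σ 1 (proj_n x))) = 0` — EXACTLY the argument shape of the frame's pin `AwayPins.hlocdS`
  (AWAYTWO-FRAME-g18 §2: `reduceH1CofreePkTorsion … (conjMap ρ.toGaloisRep.toTopRep (κ.layerSubgroup n) (rep c) 1 (I.proj n x))`); links:
  `ThetaTransport.reduceH1CofreePkTorsion_conjMap` (`red ∘ conjMap = conjMap ∘ red`, file `…RhoLayerPairingConj`), `conjMap σ 1 = conjH1 σ` on torsion classes (`rfl`),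
  `CofreeSelmerTransfer.layerLocOf_eq_zero_of_resOfLe_decomp_eq_zero` (p694757). The remaining links (4) pin, (5) exhaustion are the frame's.
* §2 **`exists_iwasawaH1_locd₂_eq_strict_of_pins`** = `DeepHalfAssembly.exists_iwasawaH1_locd₂_eq_strict_layerLocOf_of_levelwise_orthogonal` (tp2-p2x
  LEAD g18, p695648) with `hT := CofreeSelmerTransfer.toZModPow_eq_zero_of_transfer …` (p695317 §4): inputs = the v2c pins (`pair`/`hpair`,
  `locd₂`/`hlocd`), the tower `ePk` (`htower`, `hnondeg`), the transport FAMILY `Θ v hv`, `S₀`, `N₀`, `z`, and the four GLUE binders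
  (`Rel ⊇` SelRel₍C4₎-literal, `C := fun s ↦ c₂ z (loc₂ s)`, `hval` := (VAL-rel), `hH` := (H)); output = p695648's VERBATIM: `∃ x : I.H, locd₂ x = z ∧`
  levelwise [adm] ∧ GV-strict at `S₀` (∀σ) ∧ `layerLocOf`-strict at `S₀`. With §1 and the frame's (4)/(5) this is S4₂ up to the text.

References: [Kato2004Asterisque] §12.2 (p. 220), §13.8 (p. 228); [MilneADT2006] I Thm. 4.10 (b); [Kobayashi2003] (8.23) (p. 18);
[NeukirchSchmidtWingberg2008] I §5, I §6 (1.6.4); [Rubin2000] App. B §B.3.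
-/

set_option autoImplicit false
-- the Theorems namespace of this sub repeats the summit name by design (D-0017 nested layout)
set_option linter.dupNamespace false

noncomputable section

open scoped Classical NumberField

namespace Summit.BirchSwinnertonDyer.BirchSwinnertonDyer.Theorems.ThetaTransport.CofreeSelmerTransfer

open CategoryTheory Field NumberField IsDedekindDomain
  Literature.NumberTheory.EllipticCurves Literature.NumberTheory.GaloisRepresentations
  Literature.NumberTheory.EllipticCurves.Kobayashi2003 Literature.NumberTheory.EllipticCurves.GreenbergVatsal2000
  Literature.NumberTheory.EllipticCurves.GreenbergSelmer Literature.NumberTheory.EllipticCurves.CyclotomicLayer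
  Literature.NumberTheory.EllipticCurves.Sprung2012 Literature.NumberTheory.EllipticCurves.Kato2004
  Literature.NumberTheory.GaloisCohomology ZpExtension
  Literature.NumberTheory.GaloisRepresentations.DiscreteGaloisModule
  Summit.BirchSwinnertonDyer.BirchSwinnertonDyer.Theorems

/-! ## §1 S95 (1)–(3): GV-strictness ⟹ the frame's layer pairings of `red_{p^k}(conjMap σ 1 (proj_n x))` vanish -/

section PinCurrency

variable {p : ℕ} [Fact p.Prime] (S : Set (PadicAlgCl p)) {d : ℕ} (ρ : FramedGaloisRep ℚ ↥(padicCoeffIntegers S) d) (k : ℕ)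
  (κ : ZpExtension ℚ p) (w : HeightOneSpectrum (𝓞 ℚ)) (n : ℕ)

/-- `conjMap σ 1` on `H¹(U, A_ρ[N])` IS the Greenberg–Vatsal conjugation `conjH1 U A_ρ[N] σ` (the two cohomology dialects agree definitionally,
`CyclotomicLayer.discreteTopRep_cofreeTorsionBy_eq`). [cite: NeukirchSchmidtWingberg2008, I §5] -/
theorem conjMap_one_cofreeTorsion_eq_conjH1 (N : ℤ) (U : Subgroup (absoluteGaloisGroup ℚ)) [U.Normal] (σ : absoluteGaloisGroup ℚ)
    (c : H1 (cofreeTorsionGaloisModule S ρ N) U) :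
    conjMap (cofreeTorsionGaloisModule S ρ N).toTopRep U σ 1 c =
      conjH1 U ↥(AddSubgroup.torsionBy (Cofree ρ ↥(padicCoeffField S)) N) σ
        (c : subgroupH1 U ↥(AddSubgroup.torsionBy (Cofree ρ ↥(padicCoeffField S)) N)) :=
  rfl

/-- **S95 (1)–(3).** If `conj_σ (red_{p^k} y)` dies on `Γ_n ∩ D_w` (the Greenberg–Vatsal strictness clause of the assembly's output, p695648 §4),
then for ANY datum `e` on `A_ρ[p^k]` the layer pairing of `red_{p^k}(conjMap σ 1 y)` at `w` VANISHES — the argument shape of the AwayTwo frame's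
value pin `hlocdS` (`reduceH1CofreePkTorsion … (conjMap … (rep c) 1 (I.proj n x))`). Links: `reduceH1CofreePkTorsion_conjMap`, `conjMap σ 1 = conjH1 σ`
(`rfl`), `layerLocOf_eq_zero_of_resOfLe_decomp_eq_zero`, `layerPairingOf_apply`. [cite: Kato2004Asterisque, §13.8 (p. 228)]
[cite: Kobayashi2003, (8.23) (p. 18)] [cite: NeukirchSchmidtWingberg2008, I §5] -/
theorem layerPairingOf_reduce_conjMap_eq_zero_of_resOfLe_decomp_eq_zero
    (e : ↥(AddSubgroup.torsionBy (Cofree ρ ↥(padicCoeffField S)) ((p ^ k : ℕ) : ℤ)) →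
      ↥(AddSubgroup.torsionBy (Cofree ρ ↥(padicCoeffField S)) ((p ^ k : ℕ) : ℤ)) → AlgebraicClosure ℚ)
    (hμ : ∀ a b, e a b ^ (p ^ k) = 1) (hadd₁ : ∀ a₁ a₂ b, e (a₁ + a₂) b = e a₁ b * e a₂ b)
    (hadd₂ : ∀ a b₁ b₂, e a (b₁ + b₂) = e a b₁ * e a b₂)
    (hgal : ∀ (σ : absoluteGaloisGroup ℚ) (a b : ↥(AddSubgroup.torsionBy (Cofree ρ ↥(padicCoeffField S)) ((p ^ k : ℕ) : ℤ))),
      σ • e a b = e (cofreeTorsionGaloisModule S ρ _ σ a) (cofreeTorsionGaloisModule S ρ _ σ b))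
    (σ : absoluteGaloisGroup ℚ) (y : H1 (FramedGaloisRep.toGaloisRep ρ) (κ.layerSubgroup n))
    (hGV : resOfLe ↥(AddSubgroup.torsionBy (Cofree ρ ↥(padicCoeffField S)) ((p ^ k : ℕ) : ℤ))
        (inf_le_left : κ.layerSubgroup n ⊓ GreenbergSelmer.decomp w ≤ κ.layerSubgroup n)
      (conjH1 (κ.layerSubgroup n) ↥(AddSubgroup.torsionBy (Cofree ρ ↥(padicCoeffField S)) ((p ^ k : ℕ) : ℤ)) σ
        (reduceH1CofreePkTorsion S ρ k (κ.layerSubgroup n) y)) = 0) :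
    layerPairingOf (cofreeTorsionGaloisModule S ρ ((p ^ k : ℕ) : ℤ)) (p ^ k) e hμ hadd₁ hadd₂ hgal κ w n
      (reduceH1CofreePkTorsion S ρ k (κ.layerSubgroup n)
        (conjMap (FramedGaloisRep.toGaloisRep ρ).toTopRep (κ.layerSubgroup n) σ 1 y) :
          H1 (cofreeTorsionGaloisModule S ρ ((p ^ k : ℕ) : ℤ)) (κ.layerSubgroup n)) = 0 := by
  refine AddMonoidHom.ext fun t ↦ ?_
  rw [layerPairingOf_apply, reduceH1CofreePkTorsion_conjMap, conjMap_one_cofreeTorsion_eq_conjH1,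
    layerLocOf_eq_zero_of_resOfLe_decomp_eq_zero S ρ κ w ((p ^ k : ℕ) : ℤ) n _ hGV, map_zero, AddMonoidHom.zero_apply]

end PinCurrency

/-! ## §2 Item 6 from the pins: the assembly with `hT` discharged by GLUE-67 -/

section Assembly

variable {p : ℕ} [Fact p.Prime] (S : Set (PadicAlgCl p)) {d : ℕ} (ρ : FramedGaloisRep ℚ ↥(padicCoeffIntegers S) d)
  (W : WeierstrassCurve ℚ) [W.IsElliptic] {r : ℕ}
  (ePk : ∀ k : ℕ, ↥(AddSubgroup.torsionBy (Cofree ρ ↥(padicCoeffField S)) ((p ^ k : ℕ) : ℤ)) →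
    ↥(AddSubgroup.torsionBy (Cofree ρ ↥(padicCoeffField S)) ((p ^ k : ℕ) : ℤ)) → AlgebraicClosure ℚ)
  (hμPk : ∀ k a b, ePk k a b ^ (p ^ k) = 1)
  (hadd₁Pk : ∀ k a₁ a₂ b, ePk k (a₁ + a₂) b = ePk k a₁ b * ePk k a₂ b)
  (hadd₂Pk : ∀ k a b₁ b₂, ePk k a (b₁ + b₂) = ePk k a b₁ * ePk k a b₂)
  (hgalPk : ∀ k (σ : absoluteGaloisGroup ℚ) (a b : ↥(AddSubgroup.torsionBy (Cofree ρ ↥(padicCoeffField S)) ((p ^ k : ℕ) : ℤ))),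
    σ • ePk k a b = ePk k (cofreeTorsionGaloisModule S ρ _ σ a) (cofreeTorsionGaloisModule S ρ _ σ b))
  (htower : ∀ k (a b : ↥(AddSubgroup.torsionBy (Cofree ρ ↥(padicCoeffField S)) ((p ^ (k + 1) : ℕ) : ℤ))),
    ePk k ((cofreeTorsionPow S ρ k).hom a) ((cofreeTorsionPow S ρ k).hom b) = ePk (k + 1) a b ^ p)
  (hnondeg : ∀ k T, (∀ a, ePk k a T = 1) → T = 0)
  (Θ : ∀ v : HeightOneSpectrum (𝓞 ℚ), (p : 𝓞 ℚ) ∈ v.asIdeal →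
    (Cofree ρ ↥(padicCoeffField S) ≃+ (Fin r → ↥(W.geomPrimaryTorsion p))))
  (κ : ZpExtension ℚ p) (v : HeightOneSpectrum (𝓞 ℚ))
  (hΘ : ∀ (v : HeightOneSpectrum (𝓞 ℚ)) (hv : (p : 𝓞 ℚ) ∈ v.asIdeal) (δ : absoluteGaloisGroup (v.adicCompletion ℚ))
    (m : Cofree ρ ↥(padicCoeffField S)) (i : Fin r),
    Θ v hv (resGalOfEmb (closureEmb (K := ℚ) (v.adicCompletion ℚ)) δ • m) i =
      resGalOfEmb (closureEmb (K := ℚ) (v.adicCompletion ℚ)) δ • Θ v hv m i)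
  (hκ : κ.IsCyclotomic) (hv : (p : 𝓞 ℚ) ∈ v.asIdeal)
  (S₀ : Finset (HeightOneSpectrum (𝓞 ℚ))) (hS₀ : ∀ w ∈ S₀, (p : 𝓞 ℚ) ∉ w.asIdeal)
  (hρ : ∀ w : HeightOneSpectrum (𝓞 ℚ), w ∉ S₀ → (p : 𝓞 ℚ) ∉ w.asIdeal → ρ.IsUnramifiedAt w)
  {γ : absoluteGaloisGroup ℚ} (I : IwasawaH1DataCoeff (FramedGaloisRep.toGaloisRep ρ) p κ γ)
  (pair : ∀ m : ℕ, H1 (FramedGaloisRep.toGaloisRep ρ) (κ.layerSubgroup m) →+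
    ((Fin r → localLayerPointsOfEmb κ (closureEmb (K := ℚ) (v.adicCompletion ℚ)) W m) →+ ℤ_[p]))
  (hpair : ∀ (m k : ℕ) (x : H1 (FramedGaloisRep.toGaloisRep ρ) (κ.layerSubgroup m))
    (Q : Fin r → localLayerPointsOfEmb κ (closureEmb (K := ℚ) (v.adicCompletion ℚ)) W m),
    PadicInt.toZModPow k (pair m x Q) = rhoLayerPairingPk S ρ W ePk hμPk hadd₁Pk hadd₂Pk hgalPk (Θ v hv) κ v (hΘ v hv) m k x Q)
  {locd₂ : I.H →+ ((Fin r → localTowerPointsOfEmb κ (closureEmb (K := ℚ) (v.adicCompletion ℚ)) W) →+ ℤ_[p])}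
  (hlocd : ∀ (m : ℕ) (x : I.H) (Q : Fin r → localPoints W (v.adicCompletion ℚ))
    (hQ : ∀ i, Q i ∈ localLayerPointsOfEmb κ (closureEmb (K := ℚ) (v.adicCompletion ℚ)) W m),
    locd₂ x (fun i => ⟨Q i, localLayerPointsOfEmb_le_localTowerPointsOfEmb κ _ W m (hQ i)⟩) = pair m (I.proj m x) (fun i => ⟨Q i, hQ i⟩))

include htower hnondeg hκ hS₀ hρ hpair hlocd in
/-- **Item 6 (S4₂) from the pins.** For the cyclotomic `κ`, compact `𝒪`, the v2c pins (`pair`/`hpair`, `locd₂`/`hlocd`), the self-dual tower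
`ePk`, the transport FAMILY `Θ v hv`, `S₀ ∌ p`, a functional `z` on tower tuples, a floor `N₀`, and the four GLUE binders — a test set
`Rel ⊇` SelRel₍C4₎-literal, the split's functional `C` (`s ↦ c₂ z (loc₂ s)`) with its SelRel-wide VALUE pin `hval` on tower Kummer data at `v`
(S2's (VAL) shape) and the item-6 hypothesis `hH` («`C = 0` on `Rel`») — there is `x ∈ 𝐇¹_Γ(T_ρ)` with `locd₂ x = z` whose reductions
`red_{p^k}(proj_n x)` (`n ≥ N₀`) are ADMISSIBLE outside `S₀ ∪ {w ∋ p}` and STRICT at `S₀` in both currencies (Greenberg–Vatsal ∀σ, and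
`layerLocOf … w n · = 0`). = p695648 `…_layerLocOf_of_levelwise_orthogonal` ∘ p695317 `toZModPow_eq_zero_of_transfer`. The `S₀`-pin conclusion
`πₐ.locdS x = 0` then follows by §1 + the frame's pin (4) + exhaustion (5) (S95). [cite: Kato2004Asterisque, §12.2 (p. 220), §13.8 (p. 228)]
[cite: MilneADT2006, Ch. I, Thm. 4.10(b)] [cite: Rubin2000, App. B §B.3] -/
theorem exists_iwasawaH1_locd₂_eq_strict_of_pins [CompactSpace ↥(padicCoeffIntegers S)] (N₀ : ℕ)
    (z : (Fin r → localTowerPointsOfEmb κ (closureEmb (K := ℚ) (v.adicCompletion ℚ)) W) →+ ℤ_[p])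
    (Rel : Set (subgroupH1 κ.kerSubgroup (Cofree ρ ↥(padicCoeffField S))))
    (hRel : {y : subgroupH1 κ.kerSubgroup (Cofree ρ ↥(padicCoeffField S)) |
        y ∈ unramifiedOutside κ.kerSubgroup (Cofree ρ ↥(padicCoeffField S)) p (↑S₀ : Set (HeightOneSpectrum (𝓞 ℚ))) ∧
        (∀ w σ, conjH1 κ.kerSubgroup (Cofree ρ ↥(padicCoeffField S)) σ y ∈
          infKer κ.kerSubgroup (Cofree ρ ↥(padicCoeffField S)) w) ∧
        ∀ (v' : HeightOneSpectrum (𝓞 ℚ)) (hv' : (p : 𝓞 ℚ) ∈ v'.asIdeal) (σ : absoluteGaloisGroup ℚ),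
          ∃ (φ : contOneCocycles (discreteTopRep κ.kerSubgroup (Cofree ρ ↥(padicCoeffField S))))
            (Q : Fin r → localPoints W (v'.adicCompletion ℚ)) (k' : ℕ),
            oneCocycleClass (discreteTopRep κ.kerSubgroup (Cofree ρ ↥(padicCoeffField S))) φ =
              conjH1 κ.kerSubgroup (Cofree ρ ↥(padicCoeffField S)) σ y ∧
            (∀ i, (p ^ k') • Q i ∈ localTowerPointsOfEmb κ (closureEmb (K := ℚ) (v'.adicCompletion ℚ)) W) ∧
            ∀ (τ : localSubgroupOfEmb κ.kerSubgroup (closureEmb (K := ℚ) (v'.adicCompletion ℚ))) (i : Fin r),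
              pointsMapOfEmb W (closureEmb (K := ℚ) (v'.adicCompletion ℚ))
                  ((Θ v' hv' (φ.1 (resGalSubgroupOfEmb κ.kerSubgroup (closureEmb (K := ℚ) (v'.adicCompletion ℚ)) τ)) i :
                    ↥(W.geomPrimaryTorsion p)) : W.geomPoints) =
                (τ : absoluteGaloisGroup (v'.adicCompletion ℚ)) • Q i - Q i} ⊆ Rel)
    (C : subgroupH1 κ.kerSubgroup (Cofree ρ ↥(padicCoeffField S)) → AddCircle (1 : ℚ))
    (hval : ∀ s ∈ Rel, ∀ (φ : contOneCocycles (discreteTopRep κ.kerSubgroup (Cofree ρ ↥(padicCoeffField S))))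
      (Q : Fin r → localPoints W (v.adicCompletion ℚ)) (k' : ℕ)
      (hQ : ∀ i, (p ^ k') • Q i ∈ localTowerPointsOfEmb κ (closureEmb (K := ℚ) (v.adicCompletion ℚ)) W),
      oneCocycleClass (discreteTopRep κ.kerSubgroup (Cofree ρ ↥(padicCoeffField S))) φ = s →
      (∀ (τ : localSubgroupOfEmb κ.kerSubgroup (closureEmb (K := ℚ) (v.adicCompletion ℚ))) (i : Fin r),
        pointsMapOfEmb W (closureEmb (K := ℚ) (v.adicCompletion ℚ))
            ((Θ v hv (φ.1 (resGalSubgroupOfEmb κ.kerSubgroup (closureEmb (K := ℚ) (v.adicCompletion ℚ)) τ)) i :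
              ↥(W.geomPrimaryTorsion p)) : W.geomPoints) =
          (τ : absoluteGaloisGroup (v.adicCompletion ℚ)) • Q i - Q i) →
      C s = (PadicInt.toZModPow k' (z (fun i ↦ ⟨(p ^ k') • Q i, hQ i⟩))).val • ((((p : ℚ) ^ k')⁻¹ : ℚ) : AddCircle (1 : ℚ)))
    (hH : ∀ s ∈ Rel, C s = 0) :
    ∃ x : I.H, locd₂ x = z ∧ ∀ n k, N₀ ≤ n →
      (∀ w : HeightOneSpectrum (𝓞 ℚ), w ∉ ((↑S₀ : Set (HeightOneSpectrum (𝓞 ℚ))) ∪ {u | (p : 𝓞 ℚ) ∈ u.asIdeal}) →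
        ∀ 𝔓 ∈ w.primesAbove,
          resLe (cofreeTorsionGaloisModule S ρ ((p ^ k : ℕ) : ℤ)).toTopRep
            (inf_le_left : κ.layerSubgroup n ⊓ 𝔓.inertia (absoluteGaloisGroup ℚ) ≤ κ.layerSubgroup n) 1
            (reduceH1CofreePkTorsion S ρ k (κ.layerSubgroup n) (I.proj n x) :
              H1 (cofreeTorsionGaloisModule S ρ ((p ^ k : ℕ) : ℤ)) (κ.layerSubgroup n)) = 0) ∧
      (∀ w ∈ S₀, ∀ σ : absoluteGaloisGroup ℚ,
        resOfLe ↥(AddSubgroup.torsionBy (Cofree ρ ↥(padicCoeffField S)) ((p ^ k : ℕ) : ℤ))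
            (inf_le_left : κ.layerSubgroup n ⊓ GreenbergSelmer.decomp w ≤ κ.layerSubgroup n)
          (conjH1 (κ.layerSubgroup n) ↥(AddSubgroup.torsionBy (Cofree ρ ↥(padicCoeffField S)) ((p ^ k : ℕ) : ℤ)) σ
            (reduceH1CofreePkTorsion S ρ k (κ.layerSubgroup n) (I.proj n x))) = 0) ∧
      ∀ w ∈ S₀, layerLocOf (cofreeTorsionGaloisModule S ρ ((p ^ k : ℕ) : ℤ)) κ w n
        (reduceH1CofreePkTorsion S ρ k (κ.layerSubgroup n) (I.proj n x) :
          H1 (cofreeTorsionGaloisModule S ρ ((p ^ k : ℕ) : ℤ)) (κ.layerSubgroup n)) = 0 :=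
  DeepHalfAssembly.exists_iwasawaH1_locd₂_eq_strict_layerLocOf_of_levelwise_orthogonal S ρ W ePk hμPk hadd₁Pk hadd₂Pk hgalPk htower hnondeg
    (Θ v hv) κ v (hΘ v hv) hκ hv S₀ hS₀ hρ I pair hpair hlocd N₀ z
    (fun n _ k _ _ hs hs1 b Q₀ hur hinf hkum ↦ toZModPow_eq_zero_of_transfer S ρ k W κ n Θ hΘ hs hs1
      (S₀ := (↑S₀ : Set (HeightOneSpectrum (𝓞 ℚ)))) hκ (fun w hw hpw ↦ hρ w hw hpw) b (fun w hw hpw ↦ hur w hw hpw) hinf v hv Q₀ hkum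
      Rel hRel C z hval hH)

end Assembly

end Summit.BirchSwinnertonDyer.BirchSwinnertonDyer.Theorems.ThetaTransport.CofreeSelmerTransfer

end
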